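import Summits.Ventures.LatticeQCDFlow.Scaling.MeanActionTransportInstances
import Summits.Ventures.LatticeQCDFlow.Scaling.LatticeComb

/-!
# LatticeQCDFlow / Scaling — the SHARP contraction law for TV-ACCURATE flows (THEORY-2.md §3.3 v2.9, row (C2a-Cε♯)): `κ·c_lo(L)·log β − C·L^d − 2N·#P·β·ε ≤ κ·d·L^d·log coLip(T)`

HONEST FRAMING: exact (Metropolis-corrected) sampling algorithms for lattice gauge theory; figures of merit are
autocorrelation/cost numbers at stated couplings and volumes; no continuum-physics claim.

Venture `LatticeQCDFlow` (cell pub-lqcd), topic `Scaling`, FANOUT row 29 (theory-2) — OUR WORK.  The mean-action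
laws of `Scaling/MeanActionTransport.lean` charge an inexact co-Lipschitz flow `β·Δ_T`, `Δ_T = ∫ S∘T dμ₀ − ⟨S⟩_β`.
This file converts the charge into the TOTAL-VARIATION currency of `Scaling/AccurateTransportContraction.lean`
(v2.5, exponent `1/(16d)` for every `ε ≤ 1/4`):

* `integral_comp_sub_integral_le_of_map_le` **(layer cake, abstract)**: finite measures `μ₀`, `p` on a measurable
  space, `T` `μ₀`-a.e.-measurable, `f` measurable with `0 ≤ f ≤ M`, and ONE-SIDED accuracy
  `(μ₀.map T)(B) ≤ p(B) + ε` for every measurable `B` ⟹ `∫ f∘T dμ₀ − ∫ f dp ≤ M·ε`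
  (`∫ f dq = ∫_0^M q{t ≤ f} dt`, Mathlib `Integrable.integral_eq_integral_Ioc_meas_le`);
* `wilsonAction_le_two_mul_card` : `−N ≤ Re tr ρ` ⟹ `S ≤ 2N·#P`;  `meanActionExcess_le_of_map_le`:
  `Δ_T ≤ 2N·#P·ε` for a flow whose model puts at most `ε` more mass than `μ_{Λ,β}` on every measurable set;
* items `AccurateContractionSharp d N G ρ κ` **(C2a-Cε♯)** / `AccurateCoolingContraction d N G ρ κ` (between
  couplings) and their proofs `accurateContractionSharp_of_meanAction` (from `MeanActionContractionSharp`),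
  `accurateCoolingContraction_of_meanAction` (from `MeanActionContractionBetween`):
  `κ·c_lo(L)·log β − C·L^d − 2N·#P·β·ε ≤ κ·d·L^d·log K'` (resp. with `− κ·c_up(L)·log β₀`), for every `L ≥ 2`,
  `β ≥ 1`, `ε ≥ 0` and every such `T`; `SUN.accurateContraction d N` (no hypothesis left, `N ≥ 2`, `κ = N² − 1`).

READING (per site, `#P = d(d−1)/2·L^d`): `κ·d·log K' + N·d(d−1)·β·ε ≥ κ(d−1)(1/2 − 1/L)·log β − κ log β/(2L^d) − C`
— the SHARP exponent `(d−1)/(2d)` holds for TV-accurate flows whenever `ε = O(log β/β)`; at fixed `ε` the law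
degrades linearly in `β·ε` and the `1/(16d)` law of v2.5 takes over.  SU(3), `d = 4`, from the prior to
`β = 6`, `L → ∞`: `32·log K' + 216·ε ≥ 21.5 − C`.  Elementary given the tree; nothing here is cited as a fact.
-/

noncomputable section

namespace Summit.Ventures.LatticeQCDFlow.Theory2.Lattice

open MeasureTheory Metric Set Literature.MathematicalPhysics.QuantumFieldTheory

/-! ## §1. Layer cake: one-sided set-wise accuracy bounds the excess of every bounded mean -/

section LayerCake

variable {X : Type*} [MeasurableSpace X]

/-- **One-sided accuracy ⟹ one-sided bound on bounded means** (layer cake): if `(μ₀.map T)(B) ≤ p(B) + ε` for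
every measurable `B`, then `∫ f∘T dμ₀ − ∫ f dp ≤ M·ε` for every measurable `0 ≤ f ≤ M`. [folklore] -/
theorem integral_comp_sub_integral_le_of_map_le {μ₀ p : Measure X} [IsFiniteMeasure μ₀] [IsFiniteMeasure p]
    {T : X → X} (hT : AEMeasurable T μ₀) {f : X → ℝ} (hf : Measurable f) {M : ℝ} (hM : 0 ≤ M)
    (hf0 : ∀ x, 0 ≤ f x) (hfM : ∀ x, f x ≤ M) {ε : ℝ} (hε : 0 ≤ ε)
    (hacc : ∀ B : Set X, MeasurableSet B → μ₀.map T B ≤ p B + ENNReal.ofReal ε) :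
    ∫ x, f (T x) ∂μ₀ - ∫ x, f x ∂p ≤ M * ε := by
  set q : Measure X := μ₀.map T with hq
  haveI : IsFiniteMeasure q := Measure.isFiniteMeasure_map μ₀ T
  have hint : ∀ (ν : Measure X) [IsFiniteMeasure ν], Integrable f ν := fun ν _ =>
    (integrable_const M).mono' hf.aestronglyMeasurable
      (Filter.Eventually.of_forall fun x => by rw [Real.norm_eq_abs, abs_of_nonneg (hf0 x)]; exact hfM x)
  have h1 : ∫ x, f (T x) ∂μ₀ = ∫ x, f x ∂q := (integral_map hT hf.aestronglyMeasurable).symm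
  have hlc : ∀ (ν : Measure X) [IsFiniteMeasure ν],
      ∫ x, f x ∂ν = ∫ t in Ioc 0 M, ν.real {a | t ≤ f a} := fun ν _ =>
    (hint ν).integral_eq_integral_Ioc_meas_le (Filter.Eventually.of_forall hf0) (Filter.Eventually.of_forall hfM)
  -- integrability of the (antitone, bounded) layer functions on `Ioc 0 M`
  have hlay : ∀ (ν : Measure X) [IsFiniteMeasure ν],
      IntegrableOn (fun t : ℝ => ν.real {a | t ≤ f a}) (Ioc 0 M) := fun ν _ => by
    have hanti : Antitone fun t : ℝ => ν.real {a | t ≤ f a} := fun s t hst =>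
      measureReal_mono (fun a (ha : t ≤ f a) => hst.trans ha)
    refine (integrableOn_const (C := ν.real univ) (by simp)).mono' hanti.measurable.aestronglyMeasurable
      (Filter.Eventually.of_forall fun t => ?_)
    rw [Real.norm_eq_abs, abs_of_nonneg measureReal_nonneg]
    exact measureReal_mono (subset_univ _)
  have h2 : ∀ t ∈ Ioc 0 M, q.real {a | t ≤ f a} ≤ p.real {a | t ≤ f a} + ε := by
    intro t _
    have hB : MeasurableSet {a | t ≤ f a} := hf measurableSet_Ici
    have := hacc _ hB
    have hfin : p {a | t ≤ f a} + ENNReal.ofReal ε ≠ ⊤ := by finiteness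
    calc q.real {a | t ≤ f a} = (q {a | t ≤ f a}).toReal := rfl
      _ ≤ (p {a | t ≤ f a} + ENNReal.ofReal ε).toReal := ENNReal.toReal_mono hfin this
      _ = p.real {a | t ≤ f a} + ε := by rw [ENNReal.toReal_add (by finiteness) (by finiteness), ENNReal.toReal_ofReal hε]; rfl
  rw [h1, hlc q, hlc p]
  have h3 : ∫ t in Ioc 0 M, q.real {a | t ≤ f a} ≤ ∫ t in Ioc 0 M, (p.real {a | t ≤ f a} + ε) :=
    setIntegral_mono_on (hlay q) ((hlay p).add (integrableOn_const (by simp))) measurableSet_Ioc h2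
  have h4 : ∫ t in Ioc 0 M, (p.real {a | t ≤ f a} + ε) = (∫ t in Ioc 0 M, p.real {a | t ≤ f a}) + M * ε := by
    rw [integral_add (hlay p) (integrableOn_const (by simp)), setIntegral_const]
    simp [hM]
  linarith

end LayerCake

/-! ## §2. The Wilson action is bounded by `2N·#P`; the mean-action excess of an accurate flow -/

section Lattice

variable {N : ℕ} {G : Type} [Group G] [MetricSpace G] [IsTopologicalGroup G] [CompactSpace G]
  [SecondCountableTopology G] [MeasurableSpace G] [BorelSpace G]
  (ρ : G →* Matrix (Fin N) (Fin N) ℂ)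

omit [MetricSpace G] [IsTopologicalGroup G] [CompactSpace G] [SecondCountableTopology G] [MeasurableSpace G]
  [BorelSpace G] in
/-- `−N ≤ Re tr ρ` ⟹ `S(U) ≤ 2N·#P` for every configuration. [folklore] -/
theorem wilsonAction_le_two_mul_card {d L : ℕ} [NeZero L] (htr' : ∀ g, -(N : ℝ) ≤ (ρ g).trace.re)
    (U : GaugeConfig d L G) : wilsonAction ρ U ≤ 2 * N * Fintype.card (Plaquette d L) :=
  wilsonAction_le_of_mem ρ (B := univ) (s := 2 * N)
    (fun g₁ _ g₂ _ g₃ _ g₄ _ => by linarith [htr' (g₁ * g₂ * g₃ * g₄)]) U (fun e => by simp) (fun e => by simp)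

/-- **Mean-action excess of a one-sidedly accurate flow**: `0 ≤ β`, `(μ₀.map T)(B) ≤ μ_{Λ,β}(B) + ε` for all
measurable `B` ⟹ `∫ S∘T dμ₀ − ⟨S⟩_β ≤ 2N·#P·ε`. [folklore] -/
theorem meanActionExcess_le_of_map_le {d L : ℕ} [NeZero L]
    (hρ : Continuous (ρ : G → Matrix (Fin N) (Fin N) ℂ)) (htr : ∀ g, (ρ g).trace.re ≤ N)
    (htr' : ∀ g, -(N : ℝ) ≤ (ρ g).trace.re) {β : ℝ} (hβ : 0 ≤ β)
    {μ₀ : Measure (GaugeConfig d L G)} [IsProbabilityMeasure μ₀]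
    {T : GaugeConfig d L G → GaugeConfig d L G} (hT : AEMeasurable T μ₀) {ε : ℝ} (hε : 0 ≤ ε)
    (hacc : ∀ B : Set (GaugeConfig d L G), MeasurableSet B →
      μ₀.map T B ≤ wilsonMeasure (d := d) (L := L) ρ β B + ENNReal.ofReal ε) :
    ∫ x, wilsonAction ρ (T x) ∂μ₀ - wilsonExpectation (d := d) (L := L) ρ β (wilsonAction ρ) ≤
      2 * N * Fintype.card (Plaquette d L) * ε := by
  haveI := isProbabilityMeasure_wilsonMeasure_of_le (d := d) (L := L) ρ hρ htr hβ
  exact integral_comp_sub_integral_le_of_map_le hT (continuous_wilsonAction ρ hρ).measurable (by positivity)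
    (wilsonAction_nonneg ρ htr) (wilsonAction_le_two_mul_card ρ htr') hε hacc

/-! ## §3. (C2a-Cε♯) the items and the laws: the sharp contraction law for TV-accurate flows -/

end Lattice

section Defs

variable (d N : ℕ) (G : Type) [Group G] [MetricSpace G] [IsTopologicalGroup G] [CompactSpace G]
  [MeasurableSpace G] [BorelSpace G] (ρ : G →* Matrix (Fin N) (Fin N) ℂ) (κ : ℝ)

/-- **(C2a-Cε♯) SHARP CONTRACTION LAW FOR ACCURATE FLOWS FROM THE PRIOR** (OURS, THEORY-2.md §3.3 v2.9): there is
`C` with, for every `L ≥ 2`, `β ≥ 1`, `ε ≥ 0` and every `Haar^{⊗E}`-a.e.-measurable `K'`-co-Lipschitz `T` whose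
model `T_* Haar^{⊗E}` puts at most `ε` more mass than `μ_{Λ,β}` on every measurable set:
`κ·c_lo(L)·log β − C·L^d − 2N·#P·β·ε ≤ κ·d·L^d·log K'`.  Proved from `MeanActionContractionSharp`. [folklore] -/
@[conjecture]
def AccurateContractionSharp : Prop :=
  ∃ C : ℝ, ∀ (L : ℕ) [NeZero L], 2 ≤ L → ∀ β : ℝ, 1 ≤ β → ∀ ε : ℝ, 0 ≤ ε →
    ∀ (T : GaugeConfig d L G → GaugeConfig d L G) (K' : NNReal), AntilipschitzWith K' T →
      AEMeasurable T (Measure.pi fun _ : Edge d L => haarProbability G) →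
      (∀ B : Set (GaugeConfig d L G), MeasurableSet B →
        (Measure.pi fun _ : Edge d L => haarProbability G).map T B ≤
          wilsonMeasure (d := d) (L := L) ρ β B + ENNReal.ofReal ε) →
      κ * ((((d : ℝ) - 1) * (L : ℝ) ^ d * (1 / 2 - 1 / L) - 1 / 2) * Real.log β) - C * (L : ℝ) ^ d -
          2 * N * Fintype.card (Plaquette d L) * β * ε ≤
        κ * ((d : ℝ) * (L : ℝ) ^ d) * Real.log (K' : ℝ)

/-- **(C2a-Cε♯, between couplings) ACCURATE COOLING CONTRACTION LAW** (OURS, THEORY-2.md §3.3 v2.9): for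
`1 ≤ β₀ ≤ β`, `ε ≥ 0`, every `μ_{Λ,β₀}`-a.e.-measurable `K'`-co-Lipschitz `T` with
`(T_*μ_{Λ,β₀})(B) ≤ μ_{Λ,β}(B) + ε` for all measurable `B`:
`κ(c_lo(L) log β − c_up(L) log β₀) − C L^d − 2N·#P·β·ε ≤ κ d L^d log K'`.  Proved from
`MeanActionContractionBetween`. [folklore] -/
@[conjecture]
def AccurateCoolingContraction : Prop :=
  ∃ C : ℝ, ∀ (L : ℕ) [NeZero L], 2 ≤ L → ∀ β₀ β : ℝ, 1 ≤ β₀ → β₀ ≤ β → ∀ ε : ℝ, 0 ≤ ε →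
    ∀ (T : GaugeConfig d L G → GaugeConfig d L G) (K' : NNReal), AntilipschitzWith K' T →
      AEMeasurable T (wilsonMeasure (d := d) (L := L) ρ β₀) →
      (∀ B : Set (GaugeConfig d L G), MeasurableSet B →
        (wilsonMeasure (d := d) (L := L) ρ β₀).map T B ≤
          wilsonMeasure (d := d) (L := L) ρ β B + ENNReal.ofReal ε) →
      κ * ((((d : ℝ) - 1) * (L : ℝ) ^ d * (1 / 2 - 1 / L) - 1 / 2) * Real.log β -
            (((d : ℝ) - 1) * (L : ℝ) ^ d + 1) / 2 * Real.log β₀) - C * (L : ℝ) ^ d -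
          2 * N * Fintype.card (Plaquette d L) * β * ε ≤
        κ * ((d : ℝ) * (L : ℝ) ^ d) * Real.log (K' : ℝ)

end Defs

section Laws

variable {N : ℕ} {G : Type} [Group G] [MetricSpace G] [IsTopologicalGroup G] [CompactSpace G]
  [SecondCountableTopology G] [MeasurableSpace G] [BorelSpace G]
  (ρ : G →* Matrix (Fin N) (Fin N) ℂ)

/-- **(C2a-Cε♯) PROVED from the mean-action law from the prior.** [folklore] -/
theorem accurateContractionSharp_of_meanAction {d : ℕ} {κ : ℝ}
    (hρ : Continuous (ρ : G → Matrix (Fin N) (Fin N) ℂ)) (htr : ∀ g, (ρ g).trace.re ≤ N)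
    (htr' : ∀ g, -(N : ℝ) ≤ (ρ g).trace.re) (h : MeanActionContractionSharp d N G ρ κ) :
    AccurateContractionSharp d N G ρ κ := by
  obtain ⟨C, hC⟩ := h
  refine ⟨C, fun L _ hL β hβ ε hε T K' hT' hTm hacc => ?_⟩
  have hlaw := hC L hL β hβ T K' hT' hTm
  have hβ0 : 0 ≤ β := by linarith
  have hΔ := meanActionExcess_le_of_map_le ρ hρ htr htr' hβ0 hTm hε hacc
  nlinarith [mul_le_mul_of_nonneg_left hΔ hβ0]

/-- **(C2a-Cε♯, between couplings) PROVED from the mean-action law between couplings.** [folklore] -/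
theorem accurateCoolingContraction_of_meanAction {d : ℕ} {κ : ℝ}
    (hρ : Continuous (ρ : G → Matrix (Fin N) (Fin N) ℂ)) (htr : ∀ g, (ρ g).trace.re ≤ N)
    (htr' : ∀ g, -(N : ℝ) ≤ (ρ g).trace.re) (h : MeanActionContractionBetween d N G ρ κ) :
    AccurateCoolingContraction d N G ρ κ := by
  obtain ⟨C, hC⟩ := h
  refine ⟨C, fun L _ hL β₀ β hβ₀ hβ ε hε T K' hT' hTm hacc => ?_⟩
  have hlaw := hC L hL β₀ β hβ₀ hβ T K' hT' hTm
  have hβ0 : 0 ≤ β := by linarith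
  haveI := isProbabilityMeasure_wilsonMeasure_of_le (d := d) (L := L) ρ hρ htr (show (0 : ℝ) ≤ β₀ by linarith)
  have hΔ := meanActionExcess_le_of_map_le ρ hρ htr htr' hβ0 hTm hε hacc
  nlinarith [mul_le_mul_of_nonneg_left hΔ hβ0]

end Laws

/-! ## §4. `SU(N)`: no hypothesis left -/

section Instances

open scoped Matrix.Norms.Frobenius
open Literature.MathematicalPhysics.QuantumLattice (fundamentalRep continuous_fundamentalRep)

/-- **(C2a-Cε♯) for `SU(N)`, `N ≥ 2`, every `d ≥ 1`** (OURS; `SU(3)`, `d = 4` included): the sharp contraction laws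
for TV-accurate flows, from the prior and between couplings, `κ = N² − 1`, no hypothesis left. [folklore] -/
theorem SUN.accurateContraction (d N : ℕ) (hd : 1 ≤ d) (hN : 2 ≤ N) :
    @AccurateContractionSharp d N (Matrix.specialUnitaryGroup (Fin N) ℂ) _ Subtype.metricSpace
        SUN.isTopologicalGroup_hs SUN.compactSpace_hs _ SUN.borelSpace_hs (fundamentalRep (Fin N)) ((N : ℝ) ^ 2 - 1) ∧
      @AccurateCoolingContraction d N (Matrix.specialUnitaryGroup (Fin N) ℂ) _ Subtype.metricSpace
        SUN.isTopologicalGroup_hs SUN.compactSpace_hs _ SUN.borelSpace_hs (fundamentalRep (Fin N)) ((N : ℝ) ^ 2 - 1) :=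
  ⟨@accurateContractionSharp_of_meanAction N (Matrix.specialUnitaryGroup (Fin N) ℂ) _ Subtype.metricSpace
      SUN.isTopologicalGroup_hs SUN.compactSpace_hs SUN.secondCountable_hs _ SUN.borelSpace_hs
      (fundamentalRep (Fin N)) d ((N : ℝ) ^ 2 - 1) (continuous_fundamentalRep (Fin N)) (SUN.re_trace_le N)
      SUN.neg_le_re_trace (SUN.meanActionContractionSharp d N hd hN),
    @accurateCoolingContraction_of_meanAction N (Matrix.specialUnitaryGroup (Fin N) ℂ) _ Subtype.metricSpace
      SUN.isTopologicalGroup_hs SUN.compactSpace_hs SUN.secondCountable_hs _ SUN.borelSpace_hs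
      (fundamentalRep (Fin N)) d ((N : ℝ) ^ 2 - 1) (continuous_fundamentalRep (Fin N)) (SUN.re_trace_le N)
      SUN.neg_le_re_trace (SUN.meanActionContractionBetween d N hd hN)⟩

end Instances

end Summit.Ventures.LatticeQCDFlow.Theory2.Lattice
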